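import Literature.Analysis.FluidPDE.NSWave0
import HarnessLib

/-!
# Fefferman's datum and force classes under space translations

Analysis/FluidPDE proof file (theorems only; no definitions, no named facts). Plumbing about the
Clay classes of data and forces (C. L. Fefferman, Clay problem description, (4): `|∂ₓ^α u₀(x)| ≤
C_{αK} (1 + |x|)^{-K}`; (5): `f ∈ C^∞([0,∞) × ℝⁿ)` with `|∂ₓ^α ∂ₜ^m f(x, t)| ≤ C_{αmK} (1 + |x| + t)^{-K}`;
tree: `HasRapidSpatialDecay u₀`, `IsSmoothOnHalfSpace f`, `HasRapidSpaceTimeDecay f`) needed when a forced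
Navier–Stokes design is RE-CENTRED at a point `a` of space (datum `x ↦ u₀ (a + x)`, force
`(t, x) ↦ f t (a + x)`; the system has constant coefficients, tree
`IsClassicalNSSolutionOn.spaceTranslate`):

* `HasRapidSpatialDecay.spaceShift` — (4) is invariant under space translations (Mathlib
  `iteratedFDeriv_comp_add_left`; the weight costs the constant `(1 + ‖a‖)^K`, since
  `1 + ‖x‖ ≤ (1 + ‖a‖)(1 + ‖a + x‖)`);
* `IsSmoothOnHalfSpace.spaceShift` — smoothness on the closed half-space `[0, ∞) × E` is invariant (the
  translation by `(0, a)` maps the half-space onto itself);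
* `HasRapidSpaceTimeDecay.spaceShift` — (5) is invariant (Mathlib `iteratedFDerivWithin_comp_add_left`;
  `(0, a) +ᵥ ([0, ∞) × E) = [0, ∞) × E`; same weight cost).

Consumer: the cell `ns-blowup` (E–C route `PalasekTowerBreakdown`: re-centring of a registered design,
`FluidComputer/PalasekTowerRegisterGlobalRecentre.lean`).

## Tree search

`lean search 'spaceShift|comp_add_left.*HasRapid|HasRapidSpatialDecay\.(comp|translate)'`: nothing; the
time-shift twins are `IsSmoothOnHalfSpace.timeShift` / `HasRapidSpaceTimeDecay.timeShift`
(`ClayForceTimeShift`); `IsClassicalNSSolutionOn.spaceTranslate` (`ClassicalSolutionRescale`) translates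
classical solutions but says nothing about the data classes.

## References

* C. L. Fefferman, *Existence and smoothness of the Navier–Stokes equation*, Clay Mathematics
  Institute (2006), (4), (5). [FeffermanClay2006]
-/

noncomputable section

open MeasureTheory Set Function Filter Topology
open scoped ENNReal NNReal ContDiff Pointwise

namespace Literature.Analysis.FluidPDE

section SpaceShift

variable {E : Type*} [NormedAddCommGroup E] [InnerProductSpace ℝ E]
  {F : Type*} [NormedAddCommGroup F] [NormedSpace ℝ F]

omit [InnerProductSpace ℝ E] in
/-- The polynomial weight under a translation: `1 + ‖x‖ ≤ (1 + ‖a‖) (1 + ‖a + x‖)`. [folklore] -/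
private theorem one_add_norm_le_mul_shift (a x : E) :
    1 + ‖x‖ ≤ (1 + ‖a‖) * (1 + ‖a + x‖) := by
  have h1 : ‖x‖ ≤ ‖a‖ + ‖a + x‖ := by
    have := norm_sub_le (a + x) a
    simpa [add_sub_cancel_left, add_comm] using this
  nlinarith [norm_nonneg a, norm_nonneg (a + x)]

/-- **Fefferman's datum decay (4) is invariant under space translations**: if
`(1 + ‖x‖)^K ‖Dⁿ u₀ (x)‖ ≤ C_{n,K}` for all `n, K`, then the translate `x ↦ u₀ (a + x)` obeys the same
bounds with constants `(1 + ‖a‖)^K C_{n,K}` (its derivatives are those of `u₀` at `a + x`, Mathlib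
`iteratedFDeriv_comp_add_left`, and `1 + ‖x‖ ≤ (1 + ‖a‖)(1 + ‖a + x‖)`). [cite: FeffermanClay2006, (4)] -/
theorem HasRapidSpatialDecay.spaceShift {u₀ : E → F} (h : HasRapidSpatialDecay u₀)
    (a : E) : HasRapidSpatialDecay (fun x => u₀ (a + x)) := by
  intro n K
  obtain ⟨C, hC⟩ := h n K
  have hC0 : 0 ≤ C := le_trans (by positivity) (hC a)
  refine ⟨(1 + ‖a‖) ^ K * C, fun x => ?_⟩
  rw [iteratedFDeriv_comp_add_left]
  have hw : (1 + ‖x‖) ^ K ≤ (1 + ‖a‖) ^ K * (1 + ‖a + x‖) ^ K := by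
    rw [← mul_pow]
    exact pow_le_pow_left₀ (by positivity) (one_add_norm_le_mul_shift a x) K
  calc (1 + ‖x‖) ^ K * ‖iteratedFDeriv ℝ n u₀ (a + x)‖
      ≤ (1 + ‖a‖) ^ K * (1 + ‖a + x‖) ^ K * ‖iteratedFDeriv ℝ n u₀ (a + x)‖ :=
        mul_le_mul_of_nonneg_right hw (norm_nonneg _)
    _ = (1 + ‖a‖) ^ K * ((1 + ‖a + x‖) ^ K * ‖iteratedFDeriv ℝ n u₀ (a + x)‖) := by ring
    _ ≤ (1 + ‖a‖) ^ K * C := mul_le_mul_of_nonneg_left (hC (a + x)) (by positivity)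

omit [InnerProductSpace ℝ E] in
/-- Translating the closed half-space `[0, ∞) × E` by `(0, a)` gives it back. [folklore] -/
private theorem vadd_zero_Ici_prod_univ (a : E) :
    (((0 : ℝ), a) : ℝ × E) +ᵥ (Ici (0 : ℝ) ×ˢ (univ : Set E)) = Ici (0 : ℝ) ×ˢ (univ : Set E) := by
  ext z
  simp only [Set.mem_vadd_set, mem_prod, mem_Ici, mem_univ, and_true]
  constructor
  · rintro ⟨y, hy, rfl⟩
    simpa using hy
  · intro hz
    exact ⟨(z.1, z.2 - a), by simpa using hz, by ext <;> simp⟩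

omit [InnerProductSpace ℝ E] [NormedAddCommGroup F] [NormedSpace ℝ F] in
/-- Uncurrying a space shift: `uncurry (t ↦ x ↦ f t (a + x)) = uncurry f ∘ ((0, a) + ·)`. [folklore] -/
private theorem uncurry_spaceShift (f : ℝ → E → F) (a : E) :
    uncurry (fun t x => f t (a + x)) = fun z : ℝ × E => uncurry f (((0 : ℝ), a) + z) := by
  funext z
  obtain ⟨s, x⟩ := z
  simp

/-- **Fefferman's smoothness (6)/(11) on the closed half-space is invariant under space
translations**: if `w` is `C^∞` on `[0, ∞) × E` then so is `(t, x) ↦ w t (a + x)` (the translation by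
`(0, a)` maps the half-space into itself). [cite: FeffermanClay2006, (5)-(6)] -/
theorem IsSmoothOnHalfSpace.spaceShift {w : ℝ → E → F} (hw : IsSmoothOnHalfSpace w)
    (a : E) : IsSmoothOnHalfSpace (fun t x => w t (a + x)) := by
  have hg : ContDiff ℝ ∞ (fun q : ℝ × E => (q.1, a + q.2)) := by fun_prop
  have hmaps : MapsTo (fun q : ℝ × E => (q.1, a + q.2))
      (Ici (0 : ℝ) ×ˢ (univ : Set E)) (Ici (0 : ℝ) ×ˢ (univ : Set E)) := by
    intro q hq
    simpa only [mem_prod, mem_Ici, mem_univ, and_true] using hq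
  have h := ContDiffOn.comp hw hg.contDiffOn hmaps
  have he : (uncurry w ∘ fun q : ℝ × E => (q.1, a + q.2)) = uncurry fun t x => w t (a + x) := by
    funext q; obtain ⟨t, x⟩ := q; simp
  rw [he] at h
  exact h

/-- The space–time derivatives of the translated force within the half-space are those of `f` within
the half-space at the translated point (Mathlib `iteratedFDerivWithin_comp_add_left`; the translation by
`(0, a)` fixes the half-space). [folklore] -/
private theorem iteratedFDerivWithin_spaceShift (f : ℝ → E → F) (a : E) (n : ℕ)
    (t : ℝ) (x : E) :
    iteratedFDerivWithin ℝ n (uncurry fun s y => f s (a + y)) (Ici (0 : ℝ) ×ˢ univ) (t, x) =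
      iteratedFDerivWithin ℝ n (uncurry f) (Ici (0 : ℝ) ×ˢ univ) (t, a + x) := by
  rw [uncurry_spaceShift, iteratedFDerivWithin_comp_add_left, vadd_zero_Ici_prod_univ]
  have hpt : (((0 : ℝ), a) : ℝ × E) + (t, x) = (t, a + x) := by ext <;> simp
  rw [hpt]

/-- **Fefferman's space–time decay (5) is invariant under space translations**: if
`(1 + ‖x‖ + t)^K ‖Dⁿ f(t, x)‖ ≤ C_{n,K}` on the closed half-space, then `(t, x) ↦ f t (a + x)` obeys the
same bounds with constants `(1 + ‖a‖)^K C_{n,K}` (derivatives within the half-space at the translated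
point; `1 + ‖x‖ + t ≤ (1 + ‖a‖)(1 + ‖a + x‖ + t)`). [cite: FeffermanClay2006, (5)] -/
theorem HasRapidSpaceTimeDecay.spaceShift {f : ℝ → E → F}
    (hd : HasRapidSpaceTimeDecay f) (a : E) : HasRapidSpaceTimeDecay (fun t x => f t (a + x)) := by
  intro n K
  obtain ⟨C, hC⟩ := hd n K
  have hC0 : 0 ≤ C := le_trans (by positivity) (hC 0 le_rfl a)
  refine ⟨(1 + ‖a‖) ^ K * C, fun t ht x => ?_⟩
  rw [iteratedFDerivWithin_spaceShift]
  have hw1 : 1 + ‖x‖ + t ≤ (1 + ‖a‖) * (1 + ‖a + x‖ + t) := by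
    have h := one_add_norm_le_mul_shift a x
    nlinarith [norm_nonneg a]
  have hw : (1 + ‖x‖ + t) ^ K ≤ (1 + ‖a‖) ^ K * (1 + ‖a + x‖ + t) ^ K := by
    rw [← mul_pow]
    exact pow_le_pow_left₀ (by positivity) hw1 K
  calc (1 + ‖x‖ + t) ^ K * ‖iteratedFDerivWithin ℝ n (uncurry f) (Ici (0 : ℝ) ×ˢ univ) (t, a + x)‖
      ≤ (1 + ‖a‖) ^ K * (1 + ‖a + x‖ + t) ^ K *
          ‖iteratedFDerivWithin ℝ n (uncurry f) (Ici (0 : ℝ) ×ˢ univ) (t, a + x)‖ :=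
        mul_le_mul_of_nonneg_right hw (norm_nonneg _)
    _ = (1 + ‖a‖) ^ K * ((1 + ‖a + x‖ + t) ^ K *
          ‖iteratedFDerivWithin ℝ n (uncurry f) (Ici (0 : ℝ) ×ˢ univ) (t, a + x)‖) := by ring
    _ ≤ (1 + ‖a‖) ^ K * C := mul_le_mul_of_nonneg_left (hC t ht (a + x)) (by positivity)

end SpaceShift

end Literature.Analysis.FluidPDE

end
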